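import Literature.AlgebraicGeometry.Resolution.ModelTransport
import Literature.AlgebraicGeometry.Resolution.RegularLocalRingsNormal
import Literature.AlgebraicGeometry.Motives.VarietiesRegularProofs
import Mathlib.RingTheory.Etale.StandardEtale
import Mathlib.FieldTheory.Minpoly.IsIntegrallyClosed
import Mathlib.FieldTheory.IntermediateField.Adjoin.Basic
import Mathlib.RingTheory.Valuation.ValuationSubring
import HarnessLib

/-!
# The étale climb: a Hensel root over a local uniformization gives a local uniformization

Topic: `Literature/AlgebraicGeometry/Resolution`. PROOF side of `CossartPiltant2019ReductionP`
(`ArithmeticalThreefoldsLocal.lean`), the step `(LU v₀) ⇒ (LU v₀ⁱ)` of the chain in the proof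
of Cossart–Piltant 2019, Prop. 4.10 (arXiv v1 Prop. 4.8, p. 54: "`(LU v₀ⁱ)` holds by
proposition 4.9 (1) as in [CoP1] corollary 7.3"), in the form native to this tree's
valuation-theoretic files: a finite extension inside the inertia field of a valuation is
generated by a HENSELIAN ELEMENT `η` — a root of a monic `f` over the valuation ring with
`v(f'(η)) = 0` — over which the valuation ring is the local ring of the standard-étale algebra
`O[η][1/f'(η)]` (`InertiallyGeneratedValuationRings.lean`, `LocalEtaleUniformization.lean`;
Knaf–Kuhlmann 2005 §5, 2009 Lemma 3.7; Raynaud, *Anneaux locaux henséliens* X Thm. 1). The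
corresponding statement for MODELS is [CoP1] Cor. 7.3 (= Cor. 6.3 of the HAL preprint): "`R′`
is contained in the inertia field `Kⁱ(R̃/R)`, so that `R′` is local-étale over `R` by [Nagata,
*Local rings*], theorem 2 on p. 110. Then `R′` is regular, since `R` is." Here:

* `isRegularLocalRing_localization_adjoin_of_henselRoot` — PROVED: for a regular local ring `R`
  inside a valued field `(L, O)` dominating it and `η ∈ O` a root of a monic `f ∈ R[X]` with
  `v(f'(η)) = 0` (values written multiplicatively: `= 1`), the local ring of `R[η] ⊆ L` at the
  centre of `O` is regular. Proof: `R` is normal (`isIntegrallyClosed_of_isRegularLocalRing`),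
  so the minimal polynomial `μ` of `η` lies in `R[X]`, divides `f`, and `v(μ'(η)) = 0`; the
  local ring is a localization of the standard étale `R`-algebra `R[X][Y]/(μ, Yμ' − 1)`
  (Mathlib's `StandardEtalePair`; it embeds into `L` through `R[X]/(μ) ≅ R[η]`), and étale
  over regular is regular (`IsRegularLocalRing.of_etale`, heights and unramifiedness, Mathlib).
* `exists_model_adjoin_of_henselRoot` — PROVED, **the étale climb in the ambient field**: from
  climbing data at a subfield `M ∋ S` of `Ω` (a model `S[t] ⊆ O_Ω`, `t ⊆ M ⊆ Frac(S)(t)`,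
  regular at the centre) and `η ∈ O_Ω` a root of a monic `F` with `v(F'(η)) = 0` whose
  coefficients lie in the local ring `S[t]_P` (fractions `a/s`, `a, s ∈ S[t]`, `v(s) = 0` — the
  position Cossart–Piltant reach "by proposition 4.4" = principalization, cofinality of local
  uniformizations [CoP1] Cor. 4.6), climbing data at `M(η)`: the model `S[t ∪ {η}]`, whose local
  ring at the centre is that of `S[t]_P[η]` (`ModelTransport.lean`).

Everything is PROVED; no named facts are introduced and the local theorem is not used.

## Sources

* V. Cossart, O. Piltant, J. Algebra 529 (2019) 268–535 = arXiv:1412.0868, proof of Prop. 4.10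
  (arXiv v1: Prop. 4.8, p. 54). [CossartPiltant2019]
* V. Cossart, O. Piltant, J. Algebra 320 (2008) 1051–1082, Cor. 7.3 (HAL hal-00139124:
  Cor. 6.3, p. 18). [CossartPiltant2008]
* H. Knaf, F.-V. Kuhlmann, Ann. Sci. ÉNS 38 (2005), §5 (standard-étale models `O_E[x]_{g(x)}`);
  Adv. Math. 221 (2009), Lemma 3.7. M. Raynaud, LNM 169 (1970), Ch. X Thm. 1.
-/

noncomputable section

open IsLocalRing Polynomial

namespace Literature.AlgebraicGeometry.Resolution

universe u

/-! ## A Hensel root over a regular local ring -/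

section HenselRoot

variable {R L : Type u} [CommRing R] [IsRegularLocalRing R] [Field L] [Algebra R L]
  (O : ValuationSubring L)

/-- **A Hensel root over a regular local ring gives a regular local ring.** Let `R` be a regular
local ring mapped injectively into a field `L`, `O` a valuation ring of `L` containing `R` and
centred on `𝔪_R`, and `η ∈ O` a root of a monic `f ∈ R[X]` with `f'(η)` a unit of `O`. Then the
local ring of `R[η] ⊆ L` at the centre `𝔪_O ∩ R[η]` is regular: it is a localization of the
standard étale `R`-algebra `R[X][Y]/(μ, Yμ' − 1)`, `μ` the minimal polynomial of `η` (which lies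
in `R[X]`, divides `f`, and has `μ'(η)` a unit of `O`, `R` being normal).
[cite: CossartPiltant2008, Cor. 7.3 (HAL: Cor. 6.3) "local-étale over `R` … Then `R′` is regular, since `R` is"] -/
theorem isRegularLocalRing_localization_adjoin_of_henselRoot
    (hinj : Function.Injective (algebraMap R L))
    (hRO : ∀ r : R, algebraMap R L r ∈ O)
    (hdom : ∀ r ∈ maximalIdeal R, O.valuation (algebraMap R L r) < 1)
    {η : L} (hη : η ∈ O) (f : R[X]) (hf : f.Monic) (hfη : aeval η f = 0)
    (hf' : O.valuation (aeval η (derivative f)) = 1)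
    (Q : Ideal (Algebra.adjoin R ({η} : Set L))) [Q.IsPrime]
    (hQ : ∀ y : Algebra.adjoin R ({η} : Set L), y ∈ Q ↔ O.valuation (y : L) < 1) :
    IsRegularLocalRing (Localization.AtPrime Q) := by
  classical
  haveI : IsDomain R := isDomain_of_isRegularLocalRing R
  haveI : IsIntegrallyClosed R := isIntegrallyClosed_of_isRegularLocalRing R
  haveI : FaithfulSMul R L := (faithfulSMul_iff_algebraMap_injective R L).mpr hinj
  have hηB : η ∈ Algebra.adjoin R ({η} : Set L) := Algebra.self_mem_adjoin_singleton R η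
  -- `R[η] ⊆ O`
  have hBO : ∀ y : Algebra.adjoin R ({η} : Set L), (y : L) ∈ O := by
    intro y
    refine Algebra.adjoin_induction (p := fun y _ => y ∈ O) ?_ ?_ ?_ ?_ y.2
    · intro x hx
      rw [Set.mem_singleton_iff.mp hx]
      exact hη
    · exact hRO
    · exact fun _ _ _ _ hx hy => O.add_mem _ _ hx hy
    · exact fun _ _ _ _ hx hy => O.mul_mem _ _ hx hy
  have hvalB : ∀ y : Algebra.adjoin R ({η} : Set L), O.valuation (y : L) ≤ 1 := fun y =>
    (O.valuation_le_one_iff _).mpr (hBO y)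
  have haevalO : ∀ g : R[X], O.valuation (aeval η g) ≤ 1 := fun g =>
    hvalB ⟨aeval η g, Polynomial.aeval_mem_adjoin_singleton R η⟩
  -- the minimal polynomial `μ ∈ R[X]` of `η`: monic, `μ ∣ f`, `μ'(η)` a unit of `O`
  have hint : IsIntegral R η := ⟨f, hf, by rwa [← aeval_def]⟩
  set μ : R[X] := minpoly R η with hμdef
  have hμmon : μ.Monic := minpoly.monic hint
  have hμη : aeval η μ = 0 := minpoly.aeval R η
  obtain ⟨ν, hν⟩ := minpoly.isIntegrallyClosed_dvd hint hfη
  have hμ' : O.valuation (aeval η (derivative μ)) = 1 := by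
    have hder : aeval η (derivative f) = aeval η (derivative μ) * aeval η ν := by
      rw [hν, derivative_mul, map_add, map_mul, map_mul, hμη, zero_mul, add_zero]
    rw [hder, map_mul] at hf'
    refine le_antisymm (haevalO _) ?_
    calc (1 : _) = O.valuation (aeval η (derivative μ)) * O.valuation (aeval η ν) := hf'.symm
      _ ≤ O.valuation (aeval η (derivative μ)) * 1 := by gcongr; exact haevalO ν
      _ = O.valuation (aeval η (derivative μ)) := mul_one _
  have hμ'0 : aeval η (derivative μ) ≠ 0 := fun h0 => by
    rw [h0, map_zero] at hμ'
    exact zero_ne_one hμ'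
  -- the standard étale pair `(μ, μ')`
  let P : StandardEtalePair R := ⟨μ, hμmon, derivative μ, 1, 0, 1, by ring⟩
  -- the local ring `Λ = R[η]_Q` and the point `η ∈ Λ`
  let B : Subalgebra R L := Algebra.adjoin R ({η} : Set L)
  let Λ : Type u := Localization.AtPrime Q
  let ηB : B := ⟨η, hηB⟩
  have hcoe_aeval : ∀ g : R[X], ((aeval ηB g : B) : L) = aeval η g := fun g => by
    change B.val (aeval ηB g) = aeval (B.val ηB) g
    rw [aeval_algHom_apply]
  have hμB : aeval ηB μ = 0 := Subtype.ext (by rw [hcoe_aeval, hμη]; rfl)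
  have hμ'B : aeval ηB (derivative μ) ∉ Q := by
    rw [hQ, hcoe_aeval, hμ']
    exact lt_irrefl 1
  have hmapΛ : P.HasMap (algebraMap B Λ ηB) := by
    refine ⟨?_, ?_⟩
    · change aeval (algebraMap B Λ ηB) μ = 0
      rw [aeval_algebraMap_apply, hμB, map_zero]
    · change IsUnit (aeval (algebraMap B Λ ηB) (derivative μ))
      rw [aeval_algebraMap_apply]
      exact IsLocalization.map_units Λ (⟨aeval ηB (derivative μ), hμ'B⟩ : Q.primeCompl)
  let φ : P.Ring →ₐ[R] Λ := P.lift _ hmapΛ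
  have hφX : φ P.X = algebraMap B Λ ηB := P.lift_X _ hmapΛ
  have hRΛ : ∀ r : R, algebraMap R Λ r = algebraMap B Λ (algebraMap R B r) := fun r =>
    IsScalarTower.algebraMap_apply R B Λ r
  -- the prime `q = φ⁻¹(𝔪_Λ)` of the standard étale algebra lies over `𝔪_R`
  let q : Ideal P.Ring := Ideal.comap φ (maximalIdeal Λ)
  haveI hq : q.IsPrime := Ideal.IsPrime.comap φ
  have hunitval : ∀ r : R, r ∉ maximalIdeal R → ¬ O.valuation (algebraMap R L r) < 1 := by
    intro r hr hlt
    have hu : IsUnit r := not_not.mp fun h => hr ((IsLocalRing.mem_maximalIdeal r).mpr h)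
    obtain ⟨u, rfl⟩ := hu
    have h1 : O.valuation (algebraMap R L ↑u) * O.valuation (algebraMap R L ↑u⁻¹) = 1 := by
      rw [← map_mul, ← map_mul, Units.mul_inv, map_one, map_one]
    have h2 : O.valuation (algebraMap R L ↑u⁻¹) ≤ 1 := (O.valuation_le_one_iff _).mpr (hRO _)
    have h3 : O.valuation (algebraMap R L ↑u) * O.valuation (algebraMap R L ↑u⁻¹) < 1 :=
      calc O.valuation (algebraMap R L ↑u) * O.valuation (algebraMap R L ↑u⁻¹)
          ≤ O.valuation (algebraMap R L ↑u) * 1 := by gcongr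
        _ = O.valuation (algebraMap R L ↑u) := mul_one _
        _ < 1 := hlt
    rw [h1] at h3
    exact lt_irrefl _ h3
  have hmemq : ∀ r : R, r ∈ q.under R ↔ r ∈ maximalIdeal R := by
    intro r
    change φ (algebraMap R P.Ring r) ∈ maximalIdeal Λ ↔ _
    rw [φ.commutes, hRΛ, IsLocalization.AtPrime.to_map_mem_maximal_iff Λ Q, hQ]
    change O.valuation (algebraMap R L r) < 1 ↔ _
    exact ⟨fun h => not_not.mp fun hr => hunitval r hr h, hdom r⟩
  -- so `(R[X][Y]/(μ, Yμ' − 1))_q` is regular: étale over the regular local ring `R = R_{𝔪_R}`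
  haveI : IsRegularLocalRing (Localization.AtPrime (q.under R)) := by
    have H : (q.under R).primeCompl ≤ IsUnit.submonoid R := fun r hr => by
      have hr' : r ∉ maximalIdeal R := fun h => hr ((hmemq r).mpr h)
      exact not_not.mp fun h => hr' ((IsLocalRing.mem_maximalIdeal r).mpr h)
    exact IsRegularLocalRing.of_ringEquiv
      (IsLocalization.atUnits R (q.under R).primeCompl (S := Localization.AtPrime (q.under R))
        H).toRingEquiv
  haveI hregq : IsRegularLocalRing (Localization.AtPrime q) :=
    Literature.AlgebraicGeometry.Motives.IsRegularLocalRing.of_etale (R := R) q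
  haveI : IsDomain (Localization.AtPrime q) := isDomain_of_isRegularLocalRing _
  -- the standard étale algebra embeds into `L` (`θ : X ↦ η`), through `R[X]/(μ) ≅ R[η]`
  have hmapL : P.HasMap η := ⟨hμη, isUnit_iff_ne_zero.mpr hμ'0⟩
  let θ : P.Ring →ₐ[R] L := P.lift η hmapL
  have hμη' : μ.eval₂ (Algebra.ofId R L : R →+* L) η = 0 := by
    change μ.eval₂ (algebraMap R L) η = 0
    rwa [← aeval_def]
  let θ₁ : AdjoinRoot μ →ₐ[R] L := AdjoinRoot.liftAlgHom μ (Algebra.ofId R L) η hμη'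
  have hθ₁mk : ∀ g : R[X], θ₁ (AdjoinRoot.mk μ g) = aeval η g := fun g => by
    change AdjoinRoot.liftAlgHom μ (Algebra.ofId R L) η hμη' (AdjoinRoot.mk μ g) = aeval η g
    rw [AdjoinRoot.liftAlgHom_mk, aeval_def]
    rfl
  have hθ₁ : Function.Injective θ₁ := by
    rw [injective_iff_map_eq_zero]
    intro z hz
    obtain ⟨g, rfl⟩ := AdjoinRoot.mk_surjective z
    rw [hθ₁mk] at hz
    exact AdjoinRoot.mk_eq_zero.mpr (minpoly.isIntegrallyClosed_dvd hint hz)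
  haveI : IsDomain (AdjoinRoot μ) := hθ₁.isDomain θ₁.toRingHom
  set d : AdjoinRoot μ := AdjoinRoot.mk μ (derivative μ) with hddef
  have hθ₁d : IsUnit (θ₁ d) := by
    rw [hddef, hθ₁mk]
    exact hmapL.2
  have hθ₁pow : ∀ y : Submonoid.powers d, IsUnit (θ₁ y) := by
    rintro ⟨y, n, rfl⟩
    rw [map_pow]
    exact hθ₁d.pow n
  let θ₂ : Localization.Away d →ₐ[R] L := IsLocalization.liftAlgHom (M := Submonoid.powers d) hθ₁pow
  have hθ₂alg : ∀ a : AdjoinRoot μ, θ₂ (algebraMap (AdjoinRoot μ) (Localization.Away d) a) = θ₁ a :=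
    fun a => by
      change IsLocalization.lift hθ₁pow (algebraMap (AdjoinRoot μ) (Localization.Away d) a) = θ₁ a
      exact IsLocalization.lift_eq hθ₁pow a
  have hd0 : d ≠ 0 := fun h0 => by
    rw [h0, map_zero] at hθ₁d
    exact not_isUnit_zero hθ₁d
  have hθ₂ : Function.Injective θ₂ := by
    rw [injective_iff_map_eq_zero]
    intro z hz
    obtain ⟨⟨a, s⟩, has⟩ := IsLocalization.surj (Submonoid.powers d) z
    have ha : θ₁ a = 0 := by
      rw [← hθ₂alg, ← has, map_mul, hz, zero_mul]
    have ha0 : a = 0 := hθ₁ (by rw [ha, map_zero])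
    rw [ha0, map_zero] at has
    exact (IsLocalization.map_units (Localization.Away d) s).mul_left_eq_zero.mp has
  have hθ : Function.Injective θ := by
    have hfac : θ = θ₂.comp (P.equivAwayAdjoinRoot : P.Ring →ₐ[R] Localization.Away d) := by
      apply StandardEtalePair.hom_ext
      change θ P.X = θ₂ (P.equivAwayAdjoinRoot P.X)
      have hX : P.equivAwayAdjoinRoot P.X =
          algebraMap (AdjoinRoot P.f) (Localization.Away (AdjoinRoot.mk P.f P.g))
            (AdjoinRoot.root P.f) := by
        simp [StandardEtalePair.equivAwayAdjoinRoot]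
      rw [P.lift_X, hX]
      change η = θ₂ (algebraMap (AdjoinRoot μ) (Localization.Away d) (AdjoinRoot.root μ))
      rw [hθ₂alg]
      exact (AdjoinRoot.liftAlgHom_root μ (Algebra.ofId R L) η hμη').symm
    rw [hfac]
    exact hθ₂.comp P.equivAwayAdjoinRoot.injective
  haveI : IsDomain P.Ring := hθ.isDomain θ.toRingHom
  -- `Λ → L` and the compatibility `valΛ ∘ φ = θ`
  have hunitsB : ∀ y : Q.primeCompl, IsUnit (algebraMap B L y) := fun y => by
    rw [isUnit_iff_ne_zero]
    intro h0
    apply y.2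
    have : (y : B) = 0 := Subtype.ext h0
    rw [this]
    exact Q.zero_mem
  let valΛ : Λ →+* L := IsLocalization.lift (M := Q.primeCompl) hunitsB
  have hvalΛ : ∀ b : B, valΛ (algebraMap B Λ b) = b := fun b => IsLocalization.lift_eq hunitsB b
  have hvalφ : ∀ z : P.Ring, valΛ (φ z) = θ z := by
    let valΛₐ : Λ →ₐ[R] L :=
      { valΛ with
        commutes' := fun r => by
          change valΛ (algebraMap R Λ r) = algebraMap R L r
          rw [hRΛ, hvalΛ]
          rfl }
    have hcomp : valΛₐ.comp φ = θ := StandardEtalePair.hom_ext (by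
      change valΛ (φ P.X) = θ P.X
      rw [hφX, hvalΛ, P.lift_X])
    intro z
    exact DFunLike.congr_fun hcomp z
  -- `ψ : (R[X][Y]/(μ, Yμ' − 1))_q → Λ` is an isomorphism
  have hφunit : ∀ y : q.primeCompl, IsUnit (φ.toRingHom y) := fun y => by
    have hy : φ y ∉ maximalIdeal Λ := y.2
    exact not_not.mp fun h => hy ((IsLocalRing.mem_maximalIdeal _).mpr h)
  let ψ : Localization.AtPrime q →+* Λ := IsLocalization.lift (M := q.primeCompl) hφunit
  have hψ : ∀ z : P.Ring, ψ (algebraMap P.Ring (Localization.AtPrime q) z) = φ z := fun z =>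
    IsLocalization.lift_eq hφunit z
  have hψinj : Function.Injective ψ := by
    suffices h : Function.Injective (valΛ.comp ψ) by
      rw [RingHom.coe_comp] at h
      exact h.of_comp
    have hθunit : ∀ y : q.primeCompl, IsUnit (θ.toRingHom y) := fun y => by
      rw [isUnit_iff_ne_zero]
      intro h0
      apply y.2
      have : (y : P.Ring) = 0 := hθ (by rw [map_zero]; exact h0)
      rw [this]
      exact q.zero_mem
    have heq : valΛ.comp ψ = IsLocalization.lift (M := q.primeCompl) hθunit := by
      apply IsLocalization.ringHom_ext q.primeCompl
      ext z
      change valΛ (ψ (algebraMap P.Ring (Localization.AtPrime q) z)) =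
        IsLocalization.lift hθunit (algebraMap P.Ring (Localization.AtPrime q) z)
      rw [hψ, IsLocalization.lift_eq, hvalφ]
      rfl
    rw [heq]
    refine (IsLocalization.lift_injective_iff _).mpr fun x y => ⟨fun hxy => ?_, fun hxy => ?_⟩
    · rw [IsLocalization.injective (Localization.AtPrime q) q.primeCompl_le_nonZeroDivisors hxy]
    · change θ x = θ y at hxy
      rw [hθ hxy]
  have hψsurj : Function.Surjective ψ := by
    intro z
    obtain ⟨⟨b, s⟩, hz⟩ := IsLocalization.surj Q.primeCompl z
    have hpoly : ∀ c : B, ∃ g : R[X], aeval ηB g = c := by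
      intro c
      have hc : (c : L) ∈ (aeval (R := R) η).range := by
        rw [← Algebra.adjoin_singleton_eq_range_aeval]
        exact c.2
      rw [AlgHom.mem_range] at hc
      obtain ⟨g, hg⟩ := hc
      exact ⟨g, Subtype.ext (by rw [hcoe_aeval]; exact hg)⟩
    obtain ⟨gb, hgb⟩ := hpoly b
    obtain ⟨gs, hgs⟩ := hpoly s
    have hφaeval : ∀ g : R[X], φ (aeval P.X g) = algebraMap B Λ (aeval ηB g) := fun g => by
      rw [← aeval_algHom_apply, hφX, aeval_algebraMap_apply]
    have hsq : aeval P.X gs ∈ q.primeCompl := by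
      intro hmem
      have hmem' : φ (aeval P.X gs) ∈ maximalIdeal Λ := hmem
      rw [hφaeval, hgs] at hmem'
      exact s.2 ((IsLocalization.AtPrime.to_map_mem_maximal_iff Λ Q _).mp hmem')
    refine ⟨IsLocalization.mk' _ (aeval P.X gb) ⟨aeval P.X gs, hsq⟩, ?_⟩
    have hunit_s : IsUnit (algebraMap B Λ s) := IsLocalization.map_units Λ s
    refine hunit_s.mul_left_injective ?_
    change ψ _ * algebraMap B Λ s = z * algebraMap B Λ s
    rw [hz, ← hgs, ← hφaeval, ← hψ (aeval P.X gs), ← map_mul]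
    change ψ (IsLocalization.mk' _ (aeval P.X gb) ⟨aeval P.X gs, hsq⟩ *
      algebraMap P.Ring (Localization.AtPrime q) ((⟨aeval P.X gs, hsq⟩ : q.primeCompl) : P.Ring)) = _
    rw [IsLocalization.mk'_spec, hψ, hφaeval, hgb]
  exact IsRegularLocalRing.of_ringEquiv (RingEquiv.ofBijective ψ ⟨hψinj, hψsurj⟩)

end HenselRoot

/-! ## The étale climb in the ambient field -/

section Climb

/-- Two descriptions `R₁ = R₂` of the same subalgebra, with centres both cut out by `v < 1`, have
isomorphic local rings at the centre (cf. `ArithmeticalThreefoldsReduction.lean`). [folklore] -/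
private theorem isRegularLocalRing_localization_iff_of_subalgebra_eq'' {S L : Type u} [CommRing S]
    [Field L] [Algebra S L] (O : ValuationSubring L) {R₁ R₂ : Subalgebra S L} (h : R₁ = R₂)
    (P₁ : Ideal R₁) [P₁.IsPrime] (hP₁ : ∀ x : R₁, x ∈ P₁ ↔ O.valuation (x : L) < 1)
    (P₂ : Ideal R₂) [P₂.IsPrime] (hP₂ : ∀ x : R₂, x ∈ P₂ ↔ O.valuation (x : L) < 1) :
    IsRegularLocalRing (Localization.AtPrime P₁) ↔ IsRegularLocalRing (Localization.AtPrime P₂) := by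
  subst h
  have hP : P₁ = P₂ := by ext x; rw [hP₁, hP₂]
  subst hP
  exact Iff.rfl

/-- **The étale climb over an abstract local base.** For an `S`-subalgebra `T ⊆ O` of a valued
field `(L, O)` with centre `P = {v < 1}`, its localization `T_P` realised in `L` as a regular
local ring `Sₚ`, and `η ∈ O` a root of a monic `F` over `L` with `v(F'(η)) = 0` whose
coefficients are fractions `a/s`, `a, s ∈ T`, `v(s) = 0` (i.e. lie in `T_P`): the model
`S[T ∪ {η}] ⊆ O` is regular at the centre — its local ring is that of `T_P[η]`
(`isRegularLocalRing_localization_adjoin_union_iff`), regular by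
`isRegularLocalRing_localization_adjoin_of_henselRoot`.
[cite: CossartPiltant2008, Cor. 7.3 (HAL: Cor. 6.3, p. 18)] -/
theorem exists_adjoin_union_isRegularLocalRing_of_henselRoot {S L : Type u} [CommRing S]
    [Field L] [Algebra S L] (O : ValuationSubring L)
    (T : Subalgebra S L) (hTO : ∀ x : T, (x : L) ∈ O) (P : Ideal T) [P.IsPrime]
    (hP : ∀ x : T, x ∈ P ↔ O.valuation (x : L) < 1)
    (Sₚ : Type u) [CommRing Sₚ] [IsRegularLocalRing Sₚ] [Algebra T Sₚ]
    [IsLocalization.AtPrime Sₚ P] [Algebra Sₚ L] [IsScalarTower T Sₚ L] [Algebra S Sₚ]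
    [IsScalarTower S Sₚ L]
    (η : L) (hη : η ∈ O) (F : Polynomial L) (hFmon : F.Monic) (hFη : F.eval η = 0)
    (hF' : O.valuation ((derivative F).eval η) = 1)
    (hcoef : ∀ i, ∃ a s : L, a ∈ T ∧ s ∈ T ∧ O.valuation s = 1 ∧ F.coeff i * s = a) :
    ∃ hu : (Algebra.adjoin S ((T : Set L) ∪ ({η} : Set L))).toSubring ≤ O.toSubring,
      IsRegularLocalRing (Localization.AtPrime
        (Ideal.comap (Subring.inclusion hu) (maximalIdeal O))) := by
  classical
  haveI : IsDomain Sₚ := isDomain_of_isRegularLocalRing Sₚ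
  -- elements of `T_P` inside `L`: `a/b` with `a ∈ T`, `b ∈ T ∖ P`, `v(b) = 1`
  have hval : ∀ (a : T) (b : P.primeCompl),
      algebraMap Sₚ L (IsLocalization.mk' Sₚ a b) = (a : L) * (((b : T) : L))⁻¹ ∧
        O.valuation ((b : T) : L) = 1 := by
    intro a b
    have hb : O.valuation ((b : T) : L) = 1 := by
      have hle : O.valuation ((b : T) : L) ≤ 1 := (O.valuation_le_one_iff _).mpr (hTO _)
      have hnlt : ¬ O.valuation ((b : T) : L) < 1 := fun hlt => b.2 ((hP _).mpr hlt)
      exact le_antisymm hle (not_lt.mp hnlt)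
    have hb0 : ((b : T) : L) ≠ 0 := fun h0 => by rw [h0, map_zero] at hb; exact zero_ne_one hb
    refine ⟨?_, hb⟩
    have h1 := IsLocalization.mk'_spec Sₚ a b
    have h2 := congrArg (algebraMap Sₚ L) h1
    rw [map_mul, ← IsScalarTower.algebraMap_apply, ← IsScalarTower.algebraMap_apply] at h2
    have h3 : algebraMap Sₚ L (IsLocalization.mk' Sₚ a b) * ((b : T) : L) = (a : L) := h2
    rw [← h3, mul_inv_cancel_right₀ hb0]
  have hRO : ∀ r : Sₚ, algebraMap Sₚ L r ∈ O := by
    intro r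
    obtain ⟨⟨a, b⟩, rfl⟩ := IsLocalization.mk'_surjective P.primeCompl r
    obtain ⟨hab, hb⟩ := hval a b
    rw [hab]
    refine mul_mem (hTO a) ?_
    rw [← O.valuation_le_one_iff, map_inv₀, hb, inv_one]
  have hdom : ∀ r ∈ maximalIdeal Sₚ, O.valuation (algebraMap Sₚ L r) < 1 := by
    intro r hr
    obtain ⟨⟨a, b⟩, rfl⟩ := IsLocalization.mk'_surjective P.primeCompl r
    obtain ⟨hab, hb⟩ := hval a b
    have haP : a ∈ P := (IsLocalization.AtPrime.mk'_mem_maximal_iff Sₚ P a b).mp hr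
    rw [hab, map_mul, map_inv₀, hb, inv_one, mul_one]
    exact (hP a).mp haP
  have hinj : Function.Injective (algebraMap Sₚ L) := by
    intro x y hxy
    obtain ⟨⟨a, b⟩, rfl⟩ := IsLocalization.mk'_surjective P.primeCompl x
    obtain ⟨⟨a', b'⟩, rfl⟩ := IsLocalization.mk'_surjective P.primeCompl y
    rw [(hval a b).1, (hval a' b').1] at hxy
    have hb0 : ((b : T) : L) ≠ 0 := fun h0 => by
      have := (hval a b).2; rw [h0, map_zero] at this; exact zero_ne_one this
    have hb0' : ((b' : T) : L) ≠ 0 := fun h0 => by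
      have := (hval a' b').2; rw [h0, map_zero] at this; exact zero_ne_one this
    rw [IsLocalization.mk'_eq_iff_eq]
    have h : (a : L) * ((b' : T) : L) = (a' : L) * ((b : T) : L) := by
      field_simp at hxy
      linear_combination hxy
    have h' : (b' : T) * a = (b : T) * a' := Subtype.ext (by
      change ((b' : T) : L) * (a : L) = ((b : T) : L) * (a' : L)
      rw [mul_comm, h, mul_comm])
    rw [show ((b' : T) : T) * a = (b : T) * a' from h']
  -- the Hensel polynomial over `T_P`
  have hcoefR : ∀ i, F.coeff i ∈ Set.range (algebraMap Sₚ L) := fun i => by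
    obtain ⟨a, s, ha, hs, hvs, heq⟩ := hcoef i
    have hsP : (⟨s, hs⟩ : T) ∉ P := by
      rw [hP]
      change ¬ O.valuation s < 1
      rw [hvs]
      exact lt_irrefl 1
    refine ⟨IsLocalization.mk' Sₚ (⟨a, ha⟩ : T) (⟨⟨s, hs⟩, hsP⟩ : P.primeCompl), ?_⟩
    rw [(hval _ _).1]
    change a * s⁻¹ = F.coeff i
    have hs0 : s ≠ 0 := fun h0 => by rw [h0, map_zero] at hvs; exact zero_ne_one hvs
    rw [← heq, mul_inv_cancel_right₀ hs0]
  have hlifts : F ∈ Polynomial.lifts (algebraMap Sₚ L) :=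
    (Polynomial.lifts_iff_coeff_lifts F).mpr hcoefR
  obtain ⟨f, hfF, -, hfmon⟩ := Polynomial.lifts_and_degree_eq_and_monic hlifts hFmon
  have hfη : aeval η f = 0 := by
    rw [aeval_def, ← eval_map, hfF, hFη]
  have hf' : O.valuation (aeval η (derivative f)) = 1 := by
    rw [aeval_def, ← eval_map, ← derivative_map, hfF, hF']
  -- the model `T_P[η]` is regular at the centre
  have hBO : (Algebra.adjoin Sₚ ({η} : Set L)).toSubring ≤ O.toSubring := by
    intro y hy
    refine Algebra.adjoin_induction (p := fun y _ => y ∈ O) ?_ ?_ ?_ ?_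
      (show y ∈ Algebra.adjoin Sₚ ({η} : Set L) from hy)
    · intro x hx
      rw [Set.mem_singleton_iff.mp hx]
      exact hη
    · exact hRO
    · exact fun _ _ _ _ hx hy => O.add_mem _ _ hx hy
    · exact fun _ _ _ _ hx hy => O.mul_mem _ _ hx hy
  set Q : Ideal (Algebra.adjoin Sₚ ({η} : Set L)) :=
    Ideal.comap (Subring.inclusion hBO) (maximalIdeal O) with hQdef
  haveI : Q.IsPrime := Ideal.IsPrime.comap _
  have hQ : ∀ y : Algebra.adjoin Sₚ ({η} : Set L), y ∈ Q ↔ O.valuation (y : L) < 1 := fun y => by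
    rw [hQdef, Ideal.mem_comap, ValuationSubring.valuation_lt_one_iff]
    rfl
  have hregB : IsRegularLocalRing (Localization.AtPrime Q) :=
    isRegularLocalRing_localization_adjoin_of_henselRoot O hinj hRO hdom hη f hfmon hfη hf' Q hQ
  -- back to the base `S`: `S[T ∪ {η}] ⊆ T_P[η] ⊆ S[T ∪ {η}]_{centre}`
  have hAB : ∀ y : Algebra.adjoin S ((T : Set L) ∪ ({η} : Set L)),
      (y : L) ∈ Algebra.adjoin Sₚ ({η} : Set L) := fun y =>
    mem_adjoin_localization_of_mem_adjoin_union T Sₚ ({η} : Set L) y.2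
  have hu : (Algebra.adjoin S ((T : Set L) ∪ ({η} : Set L))).toSubring ≤ O.toSubring :=
    fun y hy => hBO (hAB ⟨y, hy⟩)
  refine ⟨hu, ?_⟩
  set P' : Ideal (Algebra.adjoin S ((T : Set L) ∪ ({η} : Set L))) :=
    Ideal.comap (Subring.inclusion hu) (maximalIdeal O) with hP'def
  haveI : P'.IsPrime := Ideal.IsPrime.comap _
  have hP' : ∀ y : Algebra.adjoin S ((T : Set L) ∪ ({η} : Set L)),
      y ∈ P' ↔ O.valuation (y : L) < 1 := fun y => by
    rw [hP'def, Ideal.mem_comap, ValuationSubring.valuation_lt_one_iff]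
    rfl
  exact (isRegularLocalRing_localization_adjoin_union_iff O T P Sₚ hP ({η} : Set L) P' hP' Q hQ).mpr
    hregB

variable {S Ω : Type u} [CommRing S] [Field Ω] [Algebra S Ω] (OΩ : ValuationSubring Ω)

/-- **The étale climb** (Cossart–Piltant 2019, proof of Prop. 4.10, the step
`(LU v₀) ⇒ (LU v₀ⁱ)`: "proposition 4.9 (1) as in [CoP1] corollary 7.3"; [CoP1] Cor. 7.3: "`R′`
is local-étale over `R` … Then `R′` is regular, since `R` is"). Data: climbing data at a subfield
`M ∋ S` of the ambient valued field `(Ω, O_Ω)` — a model `S[t] ⊆ O_Ω`, `t ⊆ M ⊆ Frac(S)(t)`,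
regular at the centre —, and a henselian element `η ∈ O_Ω`: a root of a monic `F` with
`v(F'(η)) = 0` whose coefficients lie in the local ring `S[t]_P` of the model (fractions `a/s`
with `a, s ∈ S[t]`, `v(s) = 0`; the position reached in the source "by proposition 4.4", i.e.
by cofinality of local uniformizations, [CoP1] Cor. 4.6). Conclusion: climbing data at `M(η)`,
namely the model `S[t ∪ {η}]` (`exists_adjoin_union_isRegularLocalRing_of_henselRoot` over the
localization `S[t]_P` realised in `Ω`).
[cite: CossartPiltant2019, proof of Prop. 4.10 (arXiv v1: Prop. 4.8, p. 54)]
[cite: CossartPiltant2008, Cor. 7.3 (HAL: Cor. 6.3, p. 18)] -/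
theorem exists_model_adjoin_of_henselRoot (M : Subfield Ω)
    (t : Finset Ω) (htM : (t : Set Ω) ⊆ M)
    (hMcl : M ≤ Subfield.closure (Set.range (algebraMap S Ω) ∪ (t : Set Ω)))
    (hTO : (Algebra.adjoin S (t : Set Ω)).toSubring ≤ OΩ.toSubring)
    (hreg : IsRegularLocalRing (Localization.AtPrime
      (Ideal.comap (Subring.inclusion hTO) (maximalIdeal OΩ))))
    (η : Ω) (hη : η ∈ OΩ) (F : Polynomial Ω) (hFmon : F.Monic) (hFη : F.eval η = 0)
    (hF' : OΩ.valuation ((derivative F).eval η) = 1)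
    (hcoef : ∀ i, ∃ a s : Ω, a ∈ Algebra.adjoin S (t : Set Ω) ∧ s ∈ Algebra.adjoin S (t : Set Ω) ∧
      OΩ.valuation s = 1 ∧ F.coeff i * s = a) :
    ∃ t' : Finset Ω,
      (t' : Set Ω) ⊆ (IntermediateField.adjoin M ({η} : Set Ω)).toSubfield ∧
      (IntermediateField.adjoin M ({η} : Set Ω)).toSubfield ≤
        Subfield.closure (Set.range (algebraMap S Ω) ∪ (t' : Set Ω)) ∧
      ∃ hTO' : (Algebra.adjoin S (t' : Set Ω)).toSubring ≤ OΩ.toSubring,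
        IsRegularLocalRing (Localization.AtPrime
          (Ideal.comap (Subring.inclusion hTO') (maximalIdeal OΩ))) := by
  classical
  let T : Subalgebra S Ω := Algebra.adjoin S (t : Set Ω)
  let P : Ideal T := Ideal.comap (Subring.inclusion hTO) (maximalIdeal OΩ)
  haveI : P.IsPrime := Ideal.IsPrime.comap _
  have hP : ∀ x : T, x ∈ P ↔ OΩ.valuation (x : Ω) < 1 := fun x => by
    change Subring.inclusion hTO x ∈ maximalIdeal OΩ ↔ _
    rw [ValuationSubring.valuation_lt_one_iff]
    rfl
  have hTO' : ∀ x : T, (x : Ω) ∈ OΩ := fun x => hTO x.2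
  -- the local ring `T_P`, realised in `Ω`
  let Sₚ : Type u := Localization.AtPrime P
  haveI : IsRegularLocalRing Sₚ := hreg
  have hunits : ∀ y : P.primeCompl, IsUnit (algebraMap T Ω y) := fun y => by
    rw [isUnit_iff_ne_zero]
    intro h0
    apply y.2
    have : (y : T) = 0 := Subtype.ext h0
    rw [this]
    exact P.zero_mem
  letI : Algebra Sₚ Ω := (IsLocalization.lift (M := P.primeCompl) hunits).toAlgebra
  haveI : IsScalarTower T Sₚ Ω :=
    IsScalarTower.of_algebraMap_eq fun a => (IsLocalization.lift_eq hunits a).symm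
  haveI : IsScalarTower S Sₚ Ω := IsScalarTower.of_algebraMap_eq fun s => by
    rw [IsScalarTower.algebraMap_apply S T Sₚ, ← IsScalarTower.algebraMap_apply T Sₚ Ω,
      ← IsScalarTower.algebraMap_apply S T Ω]
  obtain ⟨hAO, hregA⟩ := exists_adjoin_union_isRegularLocalRing_of_henselRoot OΩ T hTO' P hP Sₚ η
    hη F hFmon hFη hF' hcoef
  -- the new generating set `t' = t ∪ {η}`
  have hset : Algebra.adjoin S ((insert η t : Finset Ω) : Set Ω) =
      Algebra.adjoin S ((T : Set Ω) ∪ ({η} : Set Ω)) := by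
    rw [Finset.coe_insert]
    apply le_antisymm
    · apply Algebra.adjoin_le
      rintro z (hz | hz)
      · exact Algebra.subset_adjoin (Set.mem_union_right _ hz)
      · exact Algebra.subset_adjoin (Set.mem_union_left _ (Algebra.subset_adjoin hz))
    · apply Algebra.adjoin_le
      rintro z (hz | hz)
      · exact Algebra.adjoin_mono (Set.subset_insert _ _) hz
      · exact Algebra.subset_adjoin (Set.mem_insert_iff.mpr (Or.inl hz))
  have hTOnew : (Algebra.adjoin S ((insert η t : Finset Ω) : Set Ω)).toSubring ≤ OΩ.toSubring := by
    rw [hset]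
    exact hAO
  have hηM : η ∈ (IntermediateField.adjoin M ({η} : Set Ω)).toSubfield :=
    IntermediateField.subset_adjoin M ({η} : Set Ω) (Set.mem_singleton η)
  have hMM : ∀ m : Ω, m ∈ M → m ∈ (IntermediateField.adjoin M ({η} : Set Ω)).toSubfield :=
    fun m hm => (IntermediateField.adjoin M ({η} : Set Ω)).algebraMap_mem ⟨m, hm⟩
  refine ⟨insert η t, ?_, ?_, hTOnew, ?_⟩
  · intro z hz
    rw [Finset.coe_insert, Set.mem_insert_iff] at hz
    rcases hz with rfl | hz
    · exact hηM
    · exact hMM z (htM hz)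
  · rw [IntermediateField.adjoin_toSubfield]
    refine Subfield.closure_le.mpr ?_
    rintro z (⟨m, rfl⟩ | hz)
    · exact Subfield.closure_mono (Set.union_subset_union_right _ (by
        rw [Finset.coe_insert]; exact Set.subset_insert _ _)) (hMcl m.2)
    · rw [Set.mem_singleton_iff.mp hz]
      exact Subfield.subset_closure (Set.mem_union_right _ (by simp))
  · let P₁ : Ideal (Algebra.adjoin S ((insert η t : Finset Ω) : Set Ω)) :=
      Ideal.comap (Subring.inclusion hTOnew) (maximalIdeal OΩ)
    haveI : P₁.IsPrime := Ideal.IsPrime.comap _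
    have hP₁ : ∀ y : Algebra.adjoin S ((insert η t : Finset Ω) : Set Ω),
        y ∈ P₁ ↔ OΩ.valuation (y : Ω) < 1 := fun y => by
      change Subring.inclusion hTOnew y ∈ maximalIdeal OΩ ↔ _
      rw [ValuationSubring.valuation_lt_one_iff]
      rfl
    let P' : Ideal (Algebra.adjoin S ((T : Set Ω) ∪ ({η} : Set Ω))) :=
      Ideal.comap (Subring.inclusion hAO) (maximalIdeal OΩ)
    haveI : P'.IsPrime := Ideal.IsPrime.comap _
    have hP' : ∀ y : Algebra.adjoin S ((T : Set Ω) ∪ ({η} : Set Ω)),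
        y ∈ P' ↔ OΩ.valuation (y : Ω) < 1 := fun y => by
      change Subring.inclusion hAO y ∈ maximalIdeal OΩ ↔ _
      rw [ValuationSubring.valuation_lt_one_iff]
      rfl
    exact (isRegularLocalRing_localization_iff_of_subalgebra_eq'' OΩ hset P₁ hP₁ P' hP').mpr hregA

end Climb

end Literature.AlgebraicGeometry.Resolution

end
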